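import Summits.KontsevichZagierPeriods.Zeta5Search.WedgeDictionaryLevelDescentVFullBoundary
import HarnessLib

/-!
# Level descent on the UNCLEAN cone: `levelDescentVFull` reduced to ONE row identity for the boundary sum — the reduction, (T1) and (T2) PROVED
(FILE SPLIT by the lead lane because of the 400-line rule: §A — boundary weights, (T2), symmetry, re-indexing — is `WedgeDictionaryLevelDescentVFullBoundary.lean`; this file is §B + §C; declarations unchanged.)

HONEST FRAMING: systematic search; no irrationality claim unless certified.

OUR work (Summit side; planner gen-1 g8, 2026-08-20; memo `pub-zeta5-gen-1/D2-VFULL-PROOF-g8.md`).  `levelDescentW` and `levelDescentV` (the clean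
cone) are theorems (`WedgeDictionaryLevelDescentProof`, g7).  The remaining level-descent conjecture `levelDescentVFull` (`WedgeDictionaryLevelDescent`,
internally minted, exact instances 45/45) corrects the constant row on the UNCLEAN cone `c₁₂ > b₇` by the regularised boundary terms
`E_i(b) = Ω̄_i(b)·(μ−1)!·Σ_{x=1}^{μ} (−1)^{x−1} R₅(x)/((μ−x)!(x−1)!(x+N+1)_μ)`, `μ = i − b₇ ≥ 1` (`ldBoundary`).  This file PROVES

  `levelDescentVFull_reduction : ldSE_rowSource_stmt → levelDescentVFull`

where `ldSE_rowSource_stmt` (T3, the ONE remaining HYPOTHESIS, an identity between explicit finite sums of rationals on the rows `b₇ = 0`; exact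
instances 40/40, two independent implementations, `code/gen1/g8/y7_defs.py`) says that the boundary sum `SE(b) := Σ_i E_i(b)` obeys, on the rows, the
two-term relation of the wedges WITH SOURCE `η(b−e₂)·U(b)`:  `(d+1)·SE(b) − Π₂(b)·SE(b−e₂) = η(b−e₂)·U(b)`,  `η(a) = ∏_{j=1}^{7} a_j!·N!/(N−a_j)! / N!⁶`.
Everything else is PROVED here (no `sorry`):

§A (boundary weights).  In the index `m = b₇ − i < 0` the weight `Ω̄_i(b)` IS g7's symmetric weight `ldWeightSym b m` (`WedgeDictionaryLevelDescentWeights`):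
  the factor `1/(b₇−i)!` that `ldWeightBar` deletes from `ldWeight` is `facQ` of a negative integer, i.e. `1` (`ldWeightBar_eq_ldWeight`, `ldWeight_eq_sym`).
  We define the truncated boundary weight `ldEW b m := if ldESupp b m then ldWeightSym b m else 0` (true support: all `c_tj ≥ 0`, `σ − N ≤ m ≤ −1`), the
  kernel factor `ldKer b μ` (a function of `N`, `b₃..b₆`, `μ` only), `ldE b m := ldEW b m · ldKer b (−m)`, `ldSE b := Σ_{m=−N}^{−1} ldE b m`, and prove:
  (T2) `ldEW_cross` — the boundary weights satisfy the cross-contiguity relation of the wedges TERMWISE in `m`, by the SAME one-line identity as g7's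
  `ldW_cross` (`(c₁₂+1)(b₂−m) − (c₁₇+1)(b₇−m) = (b₂−b₇)(N+1+m−σ)`; g7's `ldStep2`, `ldStep7` carry no hypothesis `m ≥ 0`), cases interior / lower edge
  `m = σ−N−1` / a vanishing factor of `Π₂` or `Π₇` / empty; summed against the common kernel factor, `ldSE_crossRel : CrossRel ldSE b` on the extended
  region; `ldSE_swap` (`{1,2,7}`-symmetry, from `ldWeightSym_swap`); `ldSE_eq_zero_of_clean` (no boundary terms when `σ ≥ N`); `ldBoundary_sum_eq_ldSE`
  (on the half box the `i`-indexed boundary sum of `levelDescentVFull` equals `ldSE b`).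
§B (T1) `casUV_rowSource` — on the rows `b₇ = 0` the `U ∧ V` wedge obeys the SOURCED two-term relation `(d+1)·casUV(b) = Π₂·casUV(b−e₂) − η(b−e₂)·U(b)`:
  `U`, `W` satisfy the face relation `face_threeTerm` without boundary term (`coeff_rel_of_summable`), `V` with the boundary term `g(1)/((1)_N)⁶`,
  `g = −h_{b−e₂}` (`coeffV_rel_of_summable4`); `η = rowEta`.  (For `U ∧ W` the relation is homogeneous: `casUW_twoTerm`, g7.)
§C (induction).  With the CORRECTED WEDGE `casUVE := casUV + ldSE`: (T1)+(T3) give the homogeneous two-term relation for `casUVE` on the rows, (T2) and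
  `crossContiguity` its cross-contiguity, `ldSE = 0` on faces gives the face base (`ldFaceBaseV`, `coeffU_faceExt_holds`), `ldSE_swap` the transport —
  so g7's sorted `φ`-induction (`stepW_sorted` / `ldInductionW`, here `stepVF_sorted` / `ldInductionVF`) runs verbatim for the constant row on the WHOLE
  region `RW` and gives `casUVE b = ldSum V b`; `ldW_rhs_reindex` + `ldBoundary_sum_eq_ldSE` + j-freeness turn that into `levelDescentVFull`.
What (T3) is: by (T1) it is EQUIVALENT (given the rest) to `levelDescentVFull` restricted to the rows `b₇ = 0`, and it is equivalent to a closed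
DOUBLE-SUM formula for `U` itself on the rows (memo §3: the "ghost term" of the truncated weights at `m = b₂ − N − 1` is the source); at a corner it is the
double-sum (not Apéry-like single-sum) expression of the Cooper numbers `s₇(n)`.  No mechanism (creative telescoping certificate, partial fractions of the
level-5 kernel) is claimed.  What this is NOT: a proof of `levelDescentVFull`; anything about irrationality.
-/


open Finset Polynomial

namespace Summit.KontsevichZagierPeriods.Zeta5Search.WedgeDictionary

open Summit.KontsevichZagierPeriods.Zeta5Search.DualSeries
open Literature.NumberTheory.Transcendental
/-! # §B  (T1) The sourced two-term relation of the `U ∧ V` wedge on the rows `b₇ = 0` -/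


/-- The row source `η(a) = h_a(1)/((1)_N)⁶` (`h_a = hPoly a`, the telescoper of the face relation); explicitly `∏_{j=1}^{7} a_j!·N!/(N−a_j)! / N!⁶`. -/
noncomputable def rowEta (a : ℕ → ℤ) : ℚ := (hPoly a).eval 1 / BallRivoal.poch 1 (a 0).toNat ^ 6

/-- STATEMENT (T1, PROVED below as `casUV_rowSource_holds`): the sourced two-term relation of the `U ∧ V` wedge on the rows `b₇ = 0`. -/
def casUV_rowSource_stmt : Prop :=
  ∀ b : ℕ → ℤ, InBox b → b 7 = 0 → 0 ≤ dOf b → 1 ≤ b 2 → b 2 ≤ b 0 →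
    ((dOf b : ℚ) + 1) * casUV b = mixedPi2 b * casUV (lowerSlot b 2) - rowEta (lowerSlot b 2) * coeffU b

/-- **(T1) PROVED.** `(d+1)·casUV(b) = Π₂(b)·casUV(b − e₂) − η(b − e₂)·U(b)` on the rows `b₇ = 0`. -/
theorem casUV_rowSource (b : ℕ → ℤ) (hb : InBox b) (h7 : b 7 = 0) (hd : 0 ≤ dOf b) (h2 : 1 ≤ b 2) (h2N : b 2 ≤ b 0) :
    ((dOf b : ℚ) + 1) * casUV b = mixedPi2 b * casUV (lowerSlot b 2) - rowEta (lowerSlot b 2) * coeffU b := by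
  obtain ⟨h0, h1, h2', h3, h4, h5, h6, h7'⟩ := (inBox_iff b).1 hb
  have ha : InBox (lowerSlot b 2) := by
    rw [inBox_iff]; simp only [lowerSlot2_apply]; simp; omega
  have ha0 : lowerSlot b 2 0 = b 0 := lowerSlot2_zero b
  have ha2 : lowerSlot b 2 2 = b 2 - 1 := lowerSlot2_two b
  have ha7 : lowerSlot b 2 7 = 0 := by rw [lowerSlot2_seven]; exact h7
  have hda : dOf (lowerSlot b 2) = dOf b + 1 := dOf_lowerSlot2 b
  have hda1 : 1 ≤ dOf (lowerSlot b 2) := by omega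
  have hda0 : 0 ≤ dOf (lowerSlot b 2) := by omega
  have hN : 1 ≤ (b 0).toNat := by omega
  -- the three shapes `b − e₂`, `b`, `b + e₂`
  have e1 : bump (lowerSlot b 2) 1 = b := by simp only [bump, Nat.reduceAdd]; exact update2_lowerSlot2 b
  have e2 : bump b 1 = Function.update b 2 (b 2 + 1) := by simp only [bump, Nat.reduceAdd]
  have hb20 : Function.update b 2 (b 2 + 1) 0 = b 0 := Function.update_of_ne (by decide) _ _
  obtain ⟨hB2, hs2⟩ := box_update b hb hd (show 1 ∈ range 7 by simp) (show b (1 + 1) ≤ b 0 by simpa using h2N)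
  simp only [Nat.reduceAdd] at hB2 hs2
  rw [hb20] at hs2
  have hsb : ∑ j ∈ range 7, b (j + 1) ≤ 3 * b 0 + 1 := sum_le_of_dOf b hd
  have hsa : ∑ j ∈ range 7, lowerSlot b 2 (j + 1) ≤ 3 * lowerSlot b 2 0 + 1 := sum_le_of_dOf _ hda0
  -- the polynomial identity (face relation at `b − e₂`, direction 2) and its degree bound
  have hrel := face_threeTerm (lowerSlot b 2) ha ha7 (i := 1) (by simp)
  rw [e1, e2, ha0] at hrel
  have hg := natDegree_neg_hPoly_succ_le (lowerSlot b 2) ha hda1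
  rw [ha0] at hg
  -- the coefficient relations: homogeneous for `U`, sourced for `V`
  obtain ⟨hU, -⟩ := coeff_rel_of_summable (Function.update b 2 (b 2 + 1)) b (lowerSlot b 2) (b 0).toNat hN hB2 hb ha
    hs2 hsb hsa (by rw [hb20]) rfl (by rw [ha0]) (dOf (lowerSlot b 2) : ℚ) (faceGamma1 (lowerSlot b 2) 1)
    (faceGamma0 (lowerSlot b 2) 1) (-hPoly (lowerSlot b 2)) hg hrel
  have hV := coeffV_rel_of_summable4 (Function.update b 2 (b 2 + 1)) b (lowerSlot b 2) (lowerSlot b 2) (b 0).toNat hN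
    hB2 hb ha ha hs2 hsb hsa hsa (by rw [hb20]) rfl (by rw [ha0]) (by rw [ha0]) (dOf (lowerSlot b 2) : ℚ)
    (faceGamma1 (lowerSlot b 2) 1) (faceGamma0 (lowerSlot b 2) 1) 0 (-hPoly (lowerSlot b 2)) hg
    (by rw [C_0, zero_mul, add_zero]; exact hrel)
  have hβ : (-hPoly (lowerSlot b 2)).eval 1 / BallRivoal.poch 1 (b 0).toNat ^ 6 = -rowEta (lowerSlot b 2) := by
    unfold rowEta; rw [ha0, eval_neg, neg_div]
  rw [hβ] at hV
  -- the two wedges, read through j-freeness in slot 2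
  have w1 := (wedge_slot_free b hb hd (show 2 ∈ Icc 1 7 by simp) h2N (by omega)).2
  have w0 := (wedge_slot_free (lowerSlot b 2) ha hda0 (show 2 ∈ Icc 1 7 by simp) (by omega) (by omega)).2
  rw [update2_lowerSlot2] at w0
  rw [hda, faceGamma0_lowerSlot2] at hU hV
  push_cast at hU hV
  rw [← w1, ← w0]
  linear_combination coeffU b * hV - coeffV b * hU

/-- **(T1) PROVED** (named statement). -/
theorem casUV_rowSource_holds : casUV_rowSource_stmt := fun b hb h7 hd h2 h2N => casUV_rowSource b hb h7 hd h2 h2N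


/-! # §C  The corrected wedge `casUVE = casUV + ldSE`: induction on the whole region and the reduction of `levelDescentVFull` -/

/-- **(T3) — PROVED** (`ldSE_rowSource_holds`, `WedgeDictionaryLevelDescentVFullRel3`, p227810, via `ldSE_rowSource_of_rel3` p222037 and REL-3
`ldY_rel3_holds`; internally minted, first checked on exact instances 40/40, `code/gen1/g8/y6_T3.py`, `y7_defs.py`, rows `N ≤ 6` incl. the trivial zone): on the rows `b₇ = 0` (`b₁ + b₂ ≤ N`, `B` in the half box, `d ≥ 0`, `b₂ ≥ 1`) the boundary sum obeys the two-term relation of the wedges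
WITH SOURCE `η(b−e₂)·U(b)`:  `(d+1)·SE(b) − Π₂(b)·SE(b−e₂) = η(b−e₂)·U(b)`.  Equivalent (given §A, §B and g7's theorems) to `levelDescentVFull` on the rows,
and to a closed double-sum formula for `U(b)`, `b₇ = 0` (memo §3).  Why it might fail: it is an identity of explicit finite sums checked on 40 shapes only;
a failure at larger `N` would also refute `levelDescentVFull` (45/45). -/
@[conjecture] def ldSE_rowSource_stmt : Prop :=
  ∀ b : ℕ → ℤ, 0 ≤ b 0 → (∀ j ∈ Icc 1 7, 0 ≤ b j ∧ b j ≤ b 0) → (∀ j ∈ Icc 3 6, 2 * b j ≤ b 0) → 0 ≤ dOf b →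
    1 ≤ b 2 → b 7 = 0 → b 1 + b 2 ≤ b 0 →
    ((dOf b : ℚ) + 1) * ldSE b - mixedPi2 b * ldSE (lowerSlot b 2) = rowEta (lowerSlot b 2) * coeffU b

/-- The CORRECTED WEDGE `C′(b) = casUV(b) + SE(b)`. -/
noncomputable def casUVE (b : ℕ → ℤ) : ℚ := casUV b + ldSE b

/-- The constant-row claim at a shape, corrected: `C′(b) = ldSum V b`. -/
def PVF (b : ℕ → ℤ) : Prop := casUVE b = ldSum coeffV b

section transport
variable (b : ℕ → ℤ) {j k : ℕ} (hj : j ∈ ({1, 2, 7} : Finset ℕ)) (hk : k ∈ ({1, 2, 7} : Finset ℕ))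
include hj hk

/-- Transport of the corrected constant-row claim under a transposition of `{1,2,7}`. -/
theorem PVF_of_swap (hR : RW b) (h : PVF (fun i => b (Equiv.swap j k i))) : PVF b := by
  unfold PVF casUVE at h ⊢
  rwa [casUV_swap' b hj hk hR, ldSE_swap b hj hk, ldSum_swap b hj hk] at h

end transport

/-- Transport of the induction predicate for the corrected constant row. -/
theorem QVF_transport (n : ℤ) (b : ℕ → ℤ) (j k : ℕ) (hj : j ∈ ({1, 2, 7} : Finset ℕ)) (hk : k ∈ ({1, 2, 7} : Finset ℕ))
    (hQ : RW (fun i => b (Equiv.swap j k i)) → 1 ≤ (fun i => b (Equiv.swap j k i)) 0 →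
      phi (fun i => b (Equiv.swap j k i)) ≤ n → PVF (fun i => b (Equiv.swap j k i))) :
    RW b → 1 ≤ b 0 → phi b ≤ n → PVF b := fun hR hN hphi =>
  PVF_of_swap b hj hk hR (hQ (RW_swap b hj hk hR) (by simp only [swap_b0 b hj hk]; exact hN)
    (by rw [phi_swap b hj hk]; exact hphi))

/-- Face base for the corrected wedge: on a face `b₁ + b₂ = N` one has `σ ≥ N`, so `SE = 0` and the claim is g7's `ldFaceBaseV`. -/
theorem ldFaceBaseVF (hU : coeffU_faceExt_stmt) (b : ℕ → ℤ) (hN1 : 1 ≤ b 0) (hS : ∀ j ∈ Icc 1 7, 0 ≤ b j ∧ b j ≤ b 0)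
    (hd : 0 ≤ dOf b) (hface : b 1 + b 2 = b 0) : PVF b := by
  have hV := ldFaceBaseV_holds hU b hN1 hS hd hface
  have h7 := (hS 7 (by simp)).1
  have hE : ldSE b = 0 := ldSE_eq_zero_of_clean b (by unfold sigmaT; omega)
  unfold PVF casUVE
  rw [hE, add_zero]
  exact hV

/-- The corrected wedge is cross-contiguous ((T2) + `crossContiguity`). -/
theorem casUVE_crossRel (b : ℕ → ℤ) (hMix : MixedHyp b) (hS : ∀ j ∈ Icc 1 7, 0 ≤ b j ∧ b j ≤ b 0)
    (hB : ∀ j ∈ Icc 3 6, 2 * b j ≤ b 0) : CrossRel casUVE b := by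
  have hX := (crossContiguity_holds b hMix).2.1
  obtain ⟨hb, hd, h2, h7, -, -⟩ := hMix
  have hE := ldSE_crossRel b hb.1 hS hB hd h2 h7
  unfold CrossRel at hX hE ⊢
  unfold casUVE
  linear_combination hX + hE

/-- The corrected wedge obeys the HOMOGENEOUS two-term relation on the rows `b₇ = 0` ((T1) + (T3)). -/
theorem casUVE_twoTerm (hT : ldSE_rowSource_stmt) (b : ℕ → ℤ) (hb : InBox b) (hS : ∀ j ∈ Icc 1 7, 0 ≤ b j ∧ b j ≤ b 0)
    (hB : ∀ j ∈ Icc 3 6, 2 * b j ≤ b 0) (h7 : b 7 = 0) (hd : 0 ≤ dOf b) (h2 : 1 ≤ b 2) (h12 : b 1 + b 2 ≤ b 0) :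
    ((dOf b : ℚ) + 1) * casUVE b = mixedPi2 b * casUVE (lowerSlot b 2) := by
  have h1 := casUV_rowSource b hb h7 hd h2 (hS 2 (by simp)).2
  have h3 := hT b hb.1 hS hB hd h2 h7 h12
  unfold casUVE
  linear_combination h1 + h3

/-- **The sorted step for the corrected constant row** (verbatim g7's `stepW_sorted` with `(V, casUVE)` for `(W, casUW)`). -/
theorem stepVF_sorted (hU : coeffU_faceExt_stmt) (hT : ldSE_rowSource_stmt) {n : ℕ}
    (IH : ∀ b' : ℕ → ℤ, RW b' → 1 ≤ b' 0 → phi b' ≤ n → PVF b')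
    (b : ℕ → ℤ) (hR : RW b) (hN1 : 1 ≤ b 0) (hphi : phi b ≤ n + 1) (h72 : b 7 ≤ b 2) (h21 : b 2 ≤ b 1) :
    PVF b := by
  have hS := slots_of_RW b hR
  have hd : 0 ≤ dOf b := hR.2.2.2.1
  by_cases hface : b 1 + b 2 = b 0
  · exact ldFaceBaseVF hU b hN1 hS hd hface
  have hlt : b 1 + b 2 + 1 ≤ b 0 := by have := hR.2.2.2.2.1; omega
  obtain ⟨bp0, bp1, bp2, bp7, dbp, -, hlow, hRbp, hBbp, hPi2, hd1⟩ := bplus_facts b hR hN1 h72 h21 hlt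
  set bp := Function.update b 2 (b 2 + 1) with hbp
  have hSbp := slots_of_RW bp hRbp
  have hdbp : 0 ≤ dOf bp := by rw [dbp]; omega
  have h2bp : 1 ≤ bp 2 := by rw [bp2]; have := (hS 2 (by simp)).1; omega
  have h0bp : 0 ≤ bp 0 := by rw [bp0]; omega
  have hphibp : phi bp ≤ n := by unfold phi at hphi ⊢; rw [bp0, bp1, bp2, bp7]; omega
  have hPbp : PVF bp := IH bp hRbp (by rw [bp0]; exact hN1) hphibp
  by_cases h70 : b 7 = 0
  · -- two-term branch (rows): the source of `casUV` is cancelled by the source of `ldSE`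
    have h7bp : bp 7 = 0 := by rw [bp7]; exact h70
    have htt := casUVE_twoTerm hT bp (inBox_of_RW bp hRbp) hSbp hBbp h7bp hdbp h2bp (by rw [bp1, bp2, bp0]; omega)
    have key := ldRowStep2_holds coeffV casUVE bp h0bp hSbp hBbp hdbp h2bp h7bp hPi2 htt hPbp
    unfold PVF
    rwa [hlow] at key
  · -- three-term branch
    have h71 : 1 ≤ b 7 := by have := (hS 7 (by simp)).1; omega
    obtain ⟨bm0, hRbm, hphibm, -⟩ := bminus_facts b hR hN1 h72 h21 hlt h71
    have hPbm : PVF (lowerSlot bp 7) := IH _ hRbm (by rw [bm0]; exact hN1) (by rw [hbp]; omega)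
    have h7bp : 1 ≤ bp 7 := by rw [bp7]; exact h71
    have hMix : MixedHyp bp :=
      ⟨inBox_of_RW bp hRbp, hdbp, h2bp, h7bp, by rw [bp2, bp7, bp0]; omega, fun j hj => (hSbp j hj).2⟩
    have hX := casUVE_crossRel bp hMix hSbp hBbp
    have hPi : (bp 2 : ℚ) * mixedPi2 bp ≠ 0 :=
      mul_ne_zero (by exact_mod_cast (show bp 2 ≠ 0 by omega)) hPi2
    have key := ldStep27_holds coeffV casUVE bp h0bp hSbp hBbp hdbp h2bp h7bp hPi hX hPbp hPbm
    unfold PVF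
    rwa [hlow] at key

/-- **Induction for the corrected constant row on the WHOLE region** (`N ≥ 1`). -/
theorem ldInductionVF (hU : coeffU_faceExt_stmt) (hT : ldSE_rowSource_stmt) :
    ∀ (n : ℕ) (b : ℕ → ℤ), RW b → 1 ≤ b 0 → phi b ≤ n → PVF b := by
  intro n
  induction n with
  | zero =>
    intro b hR hN1 hphi
    refine sorted_reduction (fun b => RW b → 1 ≤ b 0 → phi b ≤ ((0 : ℕ) : ℤ) → PVF b)
      (fun b j k hj hk hQ => QVF_transport _ b j k hj hk hQ) ?_ b hR hN1 hphi
    intro b h72 h21 hR hN1 hphi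
    have hface : b 1 + b 2 = b 0 := by have := hR.2.2.2.2.1; unfold phi at hphi; push_cast at hphi; omega
    exact ldFaceBaseVF hU b hN1 (slots_of_RW b hR) hR.2.2.2.1 hface
  | succ n ih =>
    intro b hR hN1 hphi
    refine sorted_reduction (fun b => RW b → 1 ≤ b 0 → phi b ≤ ((n + 1 : ℕ) : ℤ) → PVF b)
      (fun b j k hj hk hQ => QVF_transport _ b j k hj hk hQ) ?_ b hR hN1 hphi
    intro b h72 h21 hR hN1 hphi
    push_cast at hphi
    exact stepVF_sorted hU hT ih b hR hN1 hphi h72 h21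

/-- The corrected m-form of `levelDescentVFull` on the whole `LDBoxHyp` region, from (T3). -/
theorem ldBoxVF_of_rowSource (hT : ldSE_rowSource_stmt) (b : ℕ → ℤ) (hb : LDBoxHyp b) : casUVE b = ldSum coeffV b := by
  by_cases hN : b 0 = 0
  · have hV := (ldZero_holds coeffU_faceExt_holds b hb hN).2
    have hs := (inBox_iff b).1 hb.1
    have hE : ldSE b = 0 := ldSE_eq_zero_of_clean b (by unfold sigmaT; omega)
    unfold casUVE
    rw [hE, add_zero]
    exact hV
  · exact ldInductionVF coeffU_faceExt_holds hT (phi b).toNat b (RW_of_LDBoxHyp b hb) (by have := hb.1.1; omega)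
      (Int.self_le_toNat _)

/-- STATEMENT (PROVED below as `levelDescentVFull_reduction_holds`): the level descent on the unclean cone follows from the row identity (T3). -/
def levelDescentVFull_reduction : Prop := ldSE_rowSource_stmt → levelDescentVFull

/-- **`levelDescentVFull` REDUCED to the one row identity `ldSE_rowSource_stmt` — PROVED.** -/
theorem levelDescentVFull_reduction_holds : levelDescentVFull_reduction := by
  intro hT b j hj hbox hB hd hcl
  have hb := ldBox_bounds b hbox hB
  have h7 := hb 7 (by simp)
  have h1 := hb 1 (by simp)
  have h2 := hb 2 (by simp)
  have hjb := hb j hj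
  obtain ⟨-, hUV⟩ := wedgeSlotFree_holds b j hj hbox hd (by omega) (by omega)
  rw [hUV, ldW_rhs_reindex coeffV b hb (b 0) (by omega), ldBoundary_sum_eq_ldSE b hbox.1 hb]
  have key := ldBoxVF_of_rowSource hT b ⟨hbox, hB, hd, hcl⟩
  unfold casUVE ldSum at key
  linear_combination key

end Summit.KontsevichZagierPeriods.Zeta5Search.WedgeDictionary
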